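/-
Copyright (c) 2026 the pub-hodgecm-mathlib formalisation cell (harness21).  Prover seat hodgecm-mathlib-K2E1-p12 (g3), Track B ∕ K2-LIT, h413 = `stmt-HodgeConjecture-24833`,
route of record `HCCMUnconditional`, ROADCARD «5Res ENDGAME BY FAMILIES» AMENDMENT #3 «GENERAL (U,τ) LADDER» rung G1; dealer K2E1-plan (g7) ruling (267) — FILE F3d-ε_τ of the C7_τ
chain: AT AN OPEN LEVEL `K′` AND A `K′`-TYPE `ω` ONLY FINITELY MANY RAY-TRIVIAL `χ` CARRY NON-ZERO `(K′, ω)`-EQUIVARIANT `χ`-SECTIONS — the `K_∞`-type twin of ★ F3d-ε p860578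
`K2E1ChiSectionLevelFinitenessU2` (K2E1-p10 (g2)).
-/
import Summits.HodgeConjecture.HodgeConjecture.Theorems.K2E1ChiSectionLevelFinitenessU2      -- ★ F3d-ε (τ = 1): `isOpen_levelSubgroup` (the open `U_w`); brings ★ F3d-ε2 `finite_setOf_heckeCharacter_trivial_on`, ★ DEFS, ★ `d₀`
import HarnessLib

/-!
# h413 ∕ Track B «K2-LIT», ROADCARD «5Res BY FAMILIES» AMENDMENT #3 rung G1, FILE F3d-ε_τ — helper `K2E1ChiSectionLevelFinitenessKTypeU2`: for an open `K′ ≤ U(J₂)(𝔸_F)` with finitely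
# many `(B(𝔸),K′)`-double cosets (representatives `W`) and ANY `K′`-type `ω : K′ → ℂ`, the ray-trivial `χ` with `chiSectionSpace χ K′ ω ≠ ⊥` form a FINITE set `S_ω(K′)` — the finite
# family index of the C7_τ exhaustion at `K′`-type `ω`

Cell `pub/hodgecm-mathlib`, crux h413 = `stmt-HodgeConjecture-24833`, route of record `HCCMUnconditional`; dealer K2E1-plan (g7) (267).  THEOREMS ONLY (no `def`, no `instance`, no notation,
no named-fact hypothesis, no `sorry`); lane `--supports stmt-HodgeConjecture-24833 --as helper` (count-neutral).  Closes no socket.  Generic quadratic datum `(F, E, c)`, `c² = 1`, `U(J₂)`;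
`ω : ↥K′ → ℂ` is an ARBITRARY function (the currency of ★ `chiSectionSpace χ K′ ω`) — NO multiplicativity, unitarity or continuity is needed for finiteness.  The level subgroup is the
INLINE `U_w := ((K′.map (MulAut.conj w)).comap ι_T).map d₀ ≤ 𝕀_E` of ★ F3d-ε (open by ★ `isOpen_levelSubgroup`).

THE MATHEMATICS ([MoeglinWaldspurger1995, I.2.17]; [GelbartJacquet1979Corvallis, §3]; [WeilBNT1967, Ch. IV §4 Thm. 7]).  If `φ ∈ chiSectionSpace χ K′ ω` and `φ(w) ≠ 0`, then for
`β ∈ B(𝔸)` with `βw = wk` (`k ∈ K′`): `χ(β₀₀)φ(w) = φ(βw) = φ(wk) = ω(k)φ(w)`, so **`χ(β₀₀) = ω(k)`** (§1) — the value of `χ` on the stabiliser is PRESCRIBED by `ω` (for `β = t ∈ T(𝔸)`,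
`k = w⁻¹tw` is determined by `t`).  Hence two ray-trivial characters `χ, χ′` both carrying a section non-zero at `w` AGREE on the open `U_w` (§2), i.e. `χ′χ⁻¹` is ray-trivial and
trivial on `U_w`; by ★ F3d-ε2 such quotients form a finite set, so `χ ↦ χ·χ₀⁻¹` (Hecke characters are a commutative group, Literature `HeckeCharacter.instCommGroup`) injects
`S_w := {χ ray-trivial | ∃ φ ∈ chiSectionSpace χ K′ ω, φ(w) ≠ 0}` into a finite set (§3).  A non-zero section is non-zero at some representative `w ∈ W`
(`φ(βwk) = ω(k)χ(β₀₀)φ(w)`), so `S_ω(K′) ⊆ ⋃_{w ∈ W} S_w` is finite (§4 HEAD), and `chiSectionSpace χ K′ ω = ⊥` for every ray-trivial `χ ∉ S_ω(K′)` (by definition).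

* §1 `chi_firstEntryUnit_eq_kType_of_section_ne_zero` (the prescribed stabiliser values), `exists_mem_apply_ne_zero_kType`.  §2 `chi_eq_chi_of_mem_levelSubgroup_kType`.
* §3 `finite_setOf_rayTrivial_section_ne_zero_at` (`S_w` finite).  §4 HEAD **`finite_setOf_rayTrivial_chiSectionSpace_ne_bot_kType`** (`S_ω(K′)` finite).

HONEST LABEL: HC_CM is proved only modulo the 7 printed citations (2 remaining named inputs: hLiu418 = `stmt-HodgeConjecture-24832`, h413 = `stmt-HodgeConjecture-24833`) until rung 0
closes; this file asserts no named fact and closes no socket.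
References: [MoeglinWaldspurger1995] C. Mœglin, J.-L. Waldspurger, *Spectral Decomposition and Eisenstein Series*, I.2.17; [GelbartJacquet1979Corvallis] S. Gelbart, H. Jacquet, *Forms of GL(2)
from the analytic point of view*, §3; [WeilBNT1967] A. Weil, *Basic Number Theory*, Ch. IV §4 Thm. 7; [Rogawski1990] J. Rogawski, *Automorphic Representations of Unitary Groups in Three
Variables*, §1.10.
-/

set_option autoImplicit false
set_option linter.dupNamespace false  -- the mandated namespace repeats the summit's segment (`HodgeConjecture.HodgeConjecture`)

noncomputable section

open Set Topology NumberField
open Literature.NumberTheory.Automorphic Literature.NumberTheory.Automorphic.UnitaryGroup Literature.NumberTheory.GaloisRepresentations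
open Summit.HodgeConjecture.HodgeConjecture.Cruxes.H413.K2E1CharacterEisensteinU2Defs
open Summit.HodgeConjecture.HodgeConjecture.Cruxes.H413.K2E1ChiSectionSpaceU2Defs
open Summit.HodgeConjecture.HodgeConjecture.Cruxes.H413.K2E1HeckeCharacterLevelFinitenessU (finite_setOf_heckeCharacter_trivial_on)
open Summit.HodgeConjecture.HodgeConjecture.Cruxes.H413.K2E1ChiSectionLevelFinitenessU2 (isOpen_levelSubgroup)
open scoped NNReal Pointwise

namespace Summit.HodgeConjecture.HodgeConjecture.Cruxes.H413.K2E1ChiSectionLevelFinitenessKTypeU2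

variable {F E : Type} [Field F] [NumberField F] [Field E] [NumberField E] [Algebra F E] {c : E ≃ₐ[F] E}

/-! ## §1 The prescribed stabiliser values -/

/-- **`χ(β₀₀) = ω(k)` ON THE STABILISER OF A POINT WHERE A `(K′, ω)`-EQUIVARIANT `χ`-SECTION IS NON-ZERO**: `φ ∈ chiSectionSpace χ K′ ω`, `φ(w) ≠ 0`, `β ∈ B(𝔸)`, `βw = wk` with
`k ∈ K′` ⟹ `χ(β₀₀) = ω(k)` (`χ(β₀₀)φ(w) = φ(βw) = φ(wk) = ω(k)φ(w)`). [cite: MoeglinWaldspurger1995, I.2.17] -/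
theorem chi_firstEntryUnit_eq_kType_of_section_ne_zero {χ : HeckeCharacter E} {K' : Subgroup (quasiSplit F E c 2).Adelic} {ω : ↥K' → ℂ}
    {φ : (quasiSplit F E c 2).Adelic → ℂ} (hφ : φ ∈ chiSectionSpace χ K' ω) {w : (quasiSplit F E c 2).Adelic} (hw : φ w ≠ 0)
    {β : (quasiSplit F E c 2).Adelic} (hβ : β ∈ borelAdelic F E c 2) {k : (quasiSplit F E c 2).Adelic} (hk : k ∈ K') (h : β * w = w * k) :
    ((χ (firstEntryUnit hβ) : ℂˣ) : ℂ) = ω ⟨k, hk⟩ := by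
  have h1 : φ (β * w) = ((χ (firstEntryUnit hβ) : ℂˣ) : ℂ) * φ w := (isChiSection_of_mem hφ).borel_mul hβ w
  have h2 : φ (β * w) = ω ⟨k, hk⟩ * φ w := by rw [h]; exact apply_mul_of_mem hφ w ⟨k, hk⟩
  rw [h2] at h1
  exact (mul_right_cancel₀ hw h1).symm

/-- A non-zero `(K′, ω)`-equivariant `χ`-section is non-zero at some double-coset representative (`φ(βwk) = ω(k)χ(β₀₀)φ(w)`). [cite: MoeglinWaldspurger1995, I.2.17] -/
theorem exists_mem_apply_ne_zero_kType {χ : HeckeCharacter E} {K' : Subgroup (quasiSplit F E c 2).Adelic} {ω : ↥K' → ℂ} (W : Finset (quasiSplit F E c 2).Adelic)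
    (hW : ∀ g : (quasiSplit F E c 2).Adelic, ∃ β ∈ borelAdelic F E c 2, ∃ w ∈ W, ∃ k ∈ K', g = β * w * k)
    {φ : (quasiSplit F E c 2).Adelic → ℂ} (hφ : φ ∈ chiSectionSpace χ K' ω) (hne : φ ≠ 0) :
    ∃ w ∈ W, φ w ≠ 0 := by
  obtain ⟨g, hg⟩ : ∃ g, φ g ≠ 0 := by
    by_contra hall
    simp only [not_exists, not_not] at hall
    exact hne (funext hall)
  obtain ⟨β, hβ, w, hw, k, hk, rfl⟩ := hW g
  refine ⟨w, hw, fun hw0 => hg ?_⟩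
  rw [apply_mul_of_mem hφ (β * w) ⟨k, hk⟩, (isChiSection_of_mem hφ).borel_mul hβ, hw0, mul_zero, mul_zero]

/-! ## §2 Two characters carrying sections non-zero at `w` agree on the open level subgroup `U_w` -/

/-- **`χ = χ′` ON `U_w = d₀(T(𝔸) ∩ wK′w⁻¹)`** when both carry `(K′, ω)`-equivariant sections non-zero at `w` (§1 with `β = t`, `k = w⁻¹tw`: both values are `ω(k)`).
[cite: MoeglinWaldspurger1995, I.2.17] -/
theorem chi_eq_chi_of_mem_levelSubgroup_kType {χ χ' : HeckeCharacter E} {K' : Subgroup (quasiSplit F E c 2).Adelic} {ω : ↥K' → ℂ}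
    {φ φ' : (quasiSplit F E c 2).Adelic → ℂ} (hφ : φ ∈ chiSectionSpace χ K' ω) (hφ' : φ' ∈ chiSectionSpace χ' K' ω) {w : (quasiSplit F E c 2).Adelic} (hw : φ w ≠ 0) (hw' : φ' w ≠ 0)
    {u : ideleGroup E} (hu : u ∈ ((K'.map (MulAut.conj w).toMonoidHom).comap ((borelAdelic F E c 2).subtype.comp (torusInBorel F E c 2).subtype)).map
      (MonoidHom.mk' (fun t : torusInBorel F E c 2 => diagUnit (t : borelAdelic F E c 2).2 0) (fun t t' => diagUnit_torus_mul_two t t' 0))) :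
    χ u = χ' u := by
  obtain ⟨t, ht, rfl⟩ := Subgroup.mem_map.1 hu
  obtain ⟨k, hk, hkt⟩ := Subgroup.mem_map.1 (Subgroup.mem_comap.1 ht)
  have h : (((t : torusInBorel F E c 2) : borelAdelic F E c 2) : (quasiSplit F E c 2).Adelic) * w = w * k := by
    have h' : w * k * w⁻¹ = (((t : torusInBorel F E c 2) : borelAdelic F E c 2) : (quasiSplit F E c 2).Adelic) := hkt
    rw [← h', inv_mul_cancel_right]
  have h1 := chi_firstEntryUnit_eq_kType_of_section_ne_zero hφ hw ((t : borelAdelic F E c 2)).2 hk h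
  have h2 := chi_firstEntryUnit_eq_kType_of_section_ne_zero hφ' hw' ((t : borelAdelic F E c 2)).2 hk h
  rw [firstEntryUnit_eq_diagUnit_zero] at h1 h2
  exact Units.val_injective (h1.trans h2.symm)

/-! ## §3 Finiteness at one representative -/

/-- **`S_w := {χ ray-trivial | ∃ φ ∈ chiSectionSpace χ K′ ω, φ(w) ≠ 0}` IS FINITE**: if non-empty, `χ ↦ χ·χ₀⁻¹` injects it into the ray-trivial characters trivial on the open `U_w`
(§2; ★ `isOpen_levelSubgroup`), a finite set by ★ F3d-ε2. [cite: WeilBNT1967, Ch. IV §4 Thm. 7] [cite: MoeglinWaldspurger1995, I.2.17] -/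
theorem finite_setOf_rayTrivial_section_ne_zero_at (hc : c * c = 1) {K' : Subgroup (quasiSplit F E c 2).Adelic} (hK'o : IsOpen (K' : Set (quasiSplit F E c 2).Adelic))
    (ω : ↥K' → ℂ) (w : (quasiSplit F E c 2).Adelic) :
    {χ : HeckeCharacter E | (∀ r : ℝ≥0ˣ, χ (posRealIdele E r) = 1) ∧ ∃ φ ∈ chiSectionSpace χ K' ω, φ w ≠ 0}.Finite := by
  classical
  set S := {χ : HeckeCharacter E | (∀ r : ℝ≥0ˣ, χ (posRealIdele E r) = 1) ∧ ∃ φ ∈ chiSectionSpace χ K' ω, φ w ≠ 0} with hS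
  rcases S.eq_empty_or_nonempty with h0 | ⟨χ₀, hχ₀ray, φ₀, hφ₀, hφ₀w⟩
  · rw [h0]; exact Set.finite_empty
  have hfin := finite_setOf_heckeCharacter_trivial_on E _ (isOpen_levelSubgroup hc hK'o w)
  refine Set.Finite.of_finite_image (f := fun χ : HeckeCharacter E => χ * χ₀⁻¹) (hfin.subset ?_) (mul_left_injective χ₀⁻¹).injOn
  rintro _ ⟨χ, ⟨hχray, φ, hφ, hφw⟩, rfl⟩
  refine ⟨fun r => ?_, fun u hu => ?_⟩
  · rw [HeckeCharacter.mul_apply, HeckeCharacter.inv_apply, hχray r, hχ₀ray r, inv_one, mul_one]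
  · rw [HeckeCharacter.mul_apply, HeckeCharacter.inv_apply, chi_eq_chi_of_mem_levelSubgroup_kType hφ hφ₀ hφw hφ₀w hu, mul_inv_cancel]

/-! ## §4 HEAD: the finite family index `S_ω(K′)` -/

/-- **THE RAY-TRIVIAL `χ` WITH `chiSectionSpace χ K′ ω ≠ ⊥` FORM A FINITE SET `S_ω(K′)`** (finitely many `(B(𝔸),K′)`-double cosets with representatives `W`; a non-zero section is non-zero
at some `w ∈ W`, §1, so `S_ω(K′) ⊆ ⋃_{w ∈ W} S_w`, §3) — the finite family index of the C7_τ HEAD_τ; for ray-trivial `χ ∉ S_ω(K′)` the space `chiSectionSpace χ K′ ω` is `⊥` by definition.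
[cite: MoeglinWaldspurger1995, I.2.17] [cite: WeilBNT1967, Ch. IV §4 Thm. 7] -/
theorem finite_setOf_rayTrivial_chiSectionSpace_ne_bot_kType (hc : c * c = 1) {K' : Subgroup (quasiSplit F E c 2).Adelic} (hK'o : IsOpen (K' : Set (quasiSplit F E c 2).Adelic))
    (W : Finset (quasiSplit F E c 2).Adelic) (hW : ∀ g : (quasiSplit F E c 2).Adelic, ∃ β ∈ borelAdelic F E c 2, ∃ w ∈ W, ∃ k ∈ K', g = β * w * k) (ω : ↥K' → ℂ) :
    {χ : HeckeCharacter E | (∀ r : ℝ≥0ˣ, χ (posRealIdele E r) = 1) ∧ chiSectionSpace χ K' ω ≠ ⊥}.Finite := by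
  refine Set.Finite.subset ((W.finite_toSet).biUnion fun w _ => finite_setOf_rayTrivial_section_ne_zero_at hc hK'o ω w) ?_
  rintro χ ⟨hray, hV⟩
  obtain ⟨φ, hφ, hφ0⟩ := (Submodule.ne_bot_iff _).1 hV
  obtain ⟨w, hw, hφw⟩ := exists_mem_apply_ne_zero_kType W hW hφ hφ0
  exact Set.mem_biUnion (Finset.mem_coe.2 hw) ⟨hray, φ, hφ, hφw⟩

end Summit.HodgeConjecture.HodgeConjecture.Cruxes.H413.K2E1ChiSectionLevelFinitenessKTypeU2

end
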